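import Mathlib

/-!
# Borel-fixed border apolarity at `(⟨3,3,3⟩, 17)` — part 8: the diagonal-sequence lemma

Crux `stmt-MatrixMultiplication-4958` (`FidelityWitnesses.FidelityGapThreeSeventeen`), line
`punctual-saturation`, stub `stub_borelFixedApolarity` (helper file for the Borel normal form half).

Pure topology, for countably many convergence requirements at once: if for every index `n` a sequence
`xs n j → x n` (`j → ∞`) and, for every `j`, a sequence `y n j k → xs n j` (`k → ∞`) are given in a
(pseudo)metric space `M n`, then ONE choice `k = k(j)` makes `y n j (k j) → x n` for EVERY `n`
(`Diagonal.exists_forall_tendsto`, `ℕ`-indexed; `Diagonal.exists_forall_tendsto_of_countable` for a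
countable index type).  This is the bookkeeping behind "a limit of Slip limits is a Slip limit" along the
Borel degenerations `g(s) · I`, `s → ∞`, in the sequential language of the line (the requirements are
indexed by a multidegree and a basis vector of the limit piece).  Registered sub-goal
`stub_borelFixedApolarity_diagonal`.  Everything proved.
-/

namespace Summit.MatrixMultiplication.MatrixMultiplication.Theorems.PunctualSaturation

-- single-conjunct summit: the `Summit.<S>.<P>` prefix repeats `MatrixMultiplication` by design (D-0017)
set_option linter.dupNamespace false

open Filter Topology

namespace Diagonal

/-- **Diagonal sequences for countably many requirements (`ℕ`-indexed).** [folklore] -/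
theorem exists_forall_tendsto {M : ℕ → Type*} [∀ n, PseudoMetricSpace (M n)] (x : ∀ n, M n)
    (xs : ∀ n, ℕ → M n) (y : ∀ n, ℕ → ℕ → M n) (hxs : ∀ n, Tendsto (xs n) atTop (𝓝 (x n)))
    (hy : ∀ n j, Tendsto (y n j) atTop (𝓝 (xs n j))) :
    ∃ k : ℕ → ℕ, ∀ n, Tendsto (fun j => y n j (k j)) atTop (𝓝 (x n)) := by
  -- at stage `j`, serve the requirements `n ≤ j` up to `1/(j+1)`
  have hstage : ∀ j : ℕ, ∃ K : ℕ, ∀ n ∈ Finset.range (j + 1),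
      dist (y n j K) (xs n j) < 1 / ((j : ℝ) + 1) := by
    intro j
    have hε : (0 : ℝ) < 1 / ((j : ℝ) + 1) := by positivity
    have h : ∀ᶠ K in atTop, ∀ n ∈ Finset.range (j + 1), dist (y n j K) (xs n j) < 1 / ((j : ℝ) + 1) := by
      rw [eventually_all_finset]
      intro n _
      exact (Metric.tendsto_nhds.1 (hy n j)) _ hε
    exact h.exists
  choose k hk using hstage
  refine ⟨k, fun n => ?_⟩
  rw [Metric.tendsto_atTop]
  intro ε hε
  obtain ⟨J₁, hJ₁⟩ := (Metric.tendsto_atTop.1 (hxs n)) (ε / 2) (half_pos hε)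
  obtain ⟨J₂, hJ₂⟩ := exists_nat_one_div_lt (half_pos hε)
  refine ⟨max (max J₁ J₂) n, fun j hj => ?_⟩
  have hj₁ : J₁ ≤ j := le_trans (le_trans (le_max_left _ _) (le_max_left _ _)) hj
  have hj₂ : J₂ ≤ j := le_trans (le_trans (le_max_right _ _) (le_max_left _ _)) hj
  have hjn : n ≤ j := le_trans (le_max_right _ _) hj
  have h1 : dist (y n j (k j)) (xs n j) < 1 / ((j : ℝ) + 1) :=
    hk j n (Finset.mem_range.2 (Nat.lt_succ_of_le hjn))
  have h2 : 1 / ((j : ℝ) + 1) ≤ 1 / ((J₂ : ℝ) + 1) :=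
    one_div_le_one_div_of_le (by positivity) (by exact_mod_cast Nat.succ_le_succ hj₂)
  calc dist (y n j (k j)) (x n) ≤ dist (y n j (k j)) (xs n j) + dist (xs n j) (x n) := dist_triangle _ _ _
    _ < ε / 2 + ε / 2 := add_lt_add (lt_of_lt_of_le h1 (h2.trans hJ₂.le)) (hJ₁ j hj₁)
    _ = ε := add_halves ε

/-- **Diagonal sequences for countably many requirements** (countable index type). [folklore] -/
theorem exists_forall_tendsto_of_countable {ι : Type*} [Countable ι] {M : ι → Type*}
    [∀ n, PseudoMetricSpace (M n)] (x : ∀ n, M n) (xs : ∀ n, ℕ → M n) (y : ∀ n, ℕ → ℕ → M n)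
    (hxs : ∀ n, Tendsto (xs n) atTop (𝓝 (x n))) (hy : ∀ n j, Tendsto (y n j) atTop (𝓝 (xs n j))) :
    ∃ k : ℕ → ℕ, ∀ n, Tendsto (fun j => y n j (k j)) atTop (𝓝 (x n)) := by
  cases isEmpty_or_nonempty ι with
  | inl h => exact ⟨id, fun n => (IsEmpty.false n).elim⟩
  | inr h =>
    obtain ⟨e, he⟩ := exists_surjective_nat ι
    obtain ⟨k, hk⟩ := exists_forall_tendsto (fun m => x (e m)) (fun m => xs (e m)) (fun m => y (e m))
      (fun m => hxs (e m)) (fun m j => hy (e m) j)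
    refine ⟨k, fun n => ?_⟩
    obtain ⟨m, rfl⟩ := he n
    exact hk m

end Diagonal

/-- **Registered sub-goal `stub_borelFixedApolarity_diagonal` of `stub_borelFixedApolarity`**: the
diagonal-sequence lemma for countably many convergence requirements in (pseudo)metric spaces.
[folklore] -/
theorem stub_borelFixedApolarity_diagonal :
    ∀ {ι : Type} [Countable ι] {M : ι → Type} [∀ n, PseudoMetricSpace (M n)] (x : ∀ n, M n)
      (xs : ∀ n, ℕ → M n) (y : ∀ n, ℕ → ℕ → M n),
      (∀ n, Filter.Tendsto (xs n) Filter.atTop (nhds (x n))) →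
      (∀ n j, Filter.Tendsto (y n j) Filter.atTop (nhds (xs n j))) →
      ∃ k : ℕ → ℕ, ∀ n, Filter.Tendsto (fun j => y n j (k j)) Filter.atTop (nhds (x n)) :=
  fun x xs y hxs hy => Diagonal.exists_forall_tendsto_of_countable x xs y hxs hy

end Summit.MatrixMultiplication.MatrixMultiplication.Theorems.PunctualSaturation
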